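import Summits.ResolutionOfSingularities.ResolutionOfSingularities.Theorems.EquisingularLiftEquisingularLiftNatNormalSheafCoordinates
import Summits.ResolutionOfSingularities.ResolutionOfSingularities.Theorems.EquisingularLiftEquisingularLiftNatP1VBTwoChartCech
import Summits.ResolutionOfSingularities.ResolutionOfSingularities.Theorems.EquisingularLiftEquisingularLiftNatDirZeroDefs
import HarnessLib

/-!
# [OURS · L1 W4.5(b) · EL♮(3) · nose residue, brick (P4-ν)] `DirStepUnobs` from a TWO-CHART certificate:
# agreeing quasi-regular generators + `Ȟ¹(𝒪_{Z̃}) = 0` on the induced cover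

Crux chain w45b, child EL♮(3) = stmt-ResolutionOfSingularities-20148 (research residue «nose»: the per-specimen
DOWNSTAIRS unobstructedness clause `DirStepUnobs` of the B‴ nose move `ReachPtNoseBTriplePrime` (…NatResidueHypDefs5) /
(H-ν1)/(H-ν2), NOSE WORD v1.3 §3 row 1 (b); desk RULING R39 (i): «`DirStepUnobs` stays a residue-side clause certified
per specimen»). res-L1-w45b-nose-w3 g2 (WIDTH seat D-0157 DOOR 1), `--supports stmt-ResolutionOfSingularities-20148 --as helper`.
OURS; NOT a statement of any manuscript; AI-written, weaker than expert review. No `sorry`; standard axioms; DEF-FREE.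

WHAT. The socket `DirStepUnobs G E hE Γ hΓ` (…NatDirZeroDefs) asks, for the inclusion `i : Γ̃ ⟶ Ẽ` of reduced structures,
for a cover of `Γ̃` by two affine opens with affine overlap on which `Ȟ¹` of the normal sheaf `𝒩 = (i^*𝓘)^∨` vanishes. This
file reduces that to RING-LEVEL data in the case of a TRIVIAL conormal bundle presented by global equations:

* `conormal_basisSection_map_eq_of_agree` — two conormal frames on `i⁻¹V₀`, `i⁻¹V₁` built from quasi-regular generators
  `x₀`, `x₁` of the ideal (output shape of `exists_conormalFrame_of_generators_of_isQuasiRegular`, p589925) which AGREE on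
  `V₀ ∩ V₁` have the same restricted basis sections on `i⁻¹V₀ ∩ i⁻¹V₁` (transition matrix `1`): injectivity of `𝓘 ↪ 𝒪` +
  naturality of the unit sections `η`.
* **`subsingleton_cechMH1_normalSheaf_of_twoCharts`** — for a closed immersion `i : Z ⟶ X` (`X` locally Noetherian), two
  affine opens `V₀, V₁ ⊆ X` with agreeing quasi-regular generators of the ideal of `i`, and the COCHAIN form of
  `Ȟ¹((i⁻¹V₀, i⁻¹V₁); 𝒪_Z) = 0` («every function on the overlap is a difference»): `Ȟ¹((i⁻¹V₀, i⁻¹V₁); 𝒩_{Z/X}) = 0`.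
  Proof = the two-chart criterion `P1VB.subsingleton_cechMH1_iff` (p53xxxx lineage) + (ν1) dual coordinates
  (…NatNormalSheafCoordinates: sections of `𝒩` ARE morphisms, `dualCoord` is a bijection, restriction = restriction of
  coordinates): split the coordinates of a section over the overlap, lift the pieces with `homOfBasisValues`.
* **`dirStepUnobs_of_twoCharts`** — the socket form: such a two-chart certificate for the inclusion `Γ̃ ⟶ Ẽ` of the reduced
  structures (charts covering `Γ̃`, affine overlap) gives `DirStepUnobs G E hE Γ hΓ` (the socket's `∀ i` is discharged by
  `i = inclusion`, `Ẽ ⟶ G` being a monomorphism).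

Customers: strict transforms of LINES through a blown-up point of `ℙ³` (`𝒩 ≅ 𝒪 ⊕ 𝒪`; Steiner's Roman surface, NOSE WORD
v1.3 (K-ν-3) / `L/res-L1-w45b-nose-w3/STEINER-TEST.md` (P4)), fibres of a morphism to a surface, and every nose whose ideal
near the curve is generated by `n − 1` functions regular on a two-affine-chart neighbourhood. NOT covered (said honestly):
non-trivial transition matrices (e.g. the iso-side conic with `𝒩 ≅ 𝒪(4)`), which need the matrix form of the criterion.

References (index only): R. Hartshorne, *Algebraic Geometry* (1977), II.5, II.8 Thm. 8.17, III.4 [cite: Hartshorne1977];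
The Stacks Project, Tag 01ED [cite: StacksProject]; R.-O. Buchweitz, H. Flenner (2003) §1 (`𝒩 = 𝓗om(𝓘/𝓘², 𝒪_Z)`)
[cite: BuchweitzFlenner2003].
-/

set_option linter.dupNamespace false -- mandated namespace `Summit.<Summit>.<Problem>` of this single-conjunct summit

noncomputable section

-- `TopCat.Presheaf`/`Scheme.Modules` are not reducible (as in Mathlib's `AlgebraicGeometry/Modules`).
set_option backward.isDefEq.respectTransparency false

open CategoryTheory CategoryTheory.Limits AlgebraicGeometry Opposite TopologicalSpace
open Literature.AlgebraicGeometry.Modules Literature.AlgebraicGeometry.Morphisms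
open Literature.AlgebraicGeometry.Deformation Literature.AlgebraicGeometry.Motives
open Literature.AlgebraicGeometry.HodgeTheory Literature.AlgebraicGeometry.Resolution

namespace Summit.ResolutionOfSingularities.ResolutionOfSingularities.Cruxes.EquisingularLiftNat.Sections

open Summit.ResolutionOfSingularities.ResolutionOfSingularities.Cruxes.EquisingularLiftNat.P1VB

/-! ### Agreeing generators give agreeing conormal basis sections on the overlap -/

section Agree

variable {X Z : Scheme.{0}} (ι : Z ⟶ X)

/-- **Transition matrix `1`**: two conormal frames on `ι⁻¹V₀`, `ι⁻¹V₁` whose basis sections are `η(s⁰_j)`, `η(s¹_j)` for ideal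
sections reading to generators `x⁰_j`, `x¹_j` which AGREE on `V₀ ∩ V₁` have equal basis sections after restriction to
`ι⁻¹V₀ ∩ ι⁻¹V₁`. [cite: Hartshorne1977, II.5 (p. 110)] (OURS spelling; folklore) -/
theorem conormal_basisSection_map_eq_of_agree (V₀ V₁ : X.Opens) {n : ℕ}
    (x₀ : Fin n → Γ(X, V₀)) (x₁ : Fin n → Γ(X, V₁))
    (s₀ : Fin n → Γ(idealModule ι, V₀)) (s₁ : Fin n → Γ(idealModule ι, V₁))
    (hs₀ : ∀ j, toRing (idealModuleι ι) V₀ (s₀ j) = x₀ j) (hs₁ : ∀ j, toRing (idealModuleι ι) V₁ (s₁ j) = x₁ j)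
    (hagree : ∀ j, X.presheaf.map (homOfLE (inf_le_left : V₀ ⊓ V₁ ≤ V₀)).op (x₀ j) =
      X.presheaf.map (homOfLE (inf_le_right : V₀ ⊓ V₁ ≤ V₁)).op (x₁ j))
    (e₀ : SheafOfModules.free (Fin n) ≅ (conormalSheaf ι).over (ι ⁻¹ᵁ V₀))
    (e₁ : SheafOfModules.free (Fin n) ≅ (conormalSheaf ι).over (ι ⁻¹ᵁ V₁))
    (he₀ : ∀ j, basisSection e₀ j = unitSectionLE ι (idealModule ι) (le_refl _) (s₀ j))
    (he₁ : ∀ j, basisSection e₁ j = unitSectionLE ι (idealModule ι) (le_refl _) (s₁ j)) (j : Fin n) :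
    (conormalSheaf ι).presheaf.map (homOfLE (inf_le_left : ι ⁻¹ᵁ V₀ ⊓ ι ⁻¹ᵁ V₁ ≤ ι ⁻¹ᵁ V₀)).op (basisSection e₀ j) =
      (conormalSheaf ι).presheaf.map (homOfLE (inf_le_right : ι ⁻¹ᵁ V₀ ⊓ ι ⁻¹ᵁ V₁ ≤ ι ⁻¹ᵁ V₁)).op (basisSection e₁ j) := by
  -- the two ideal sections restricted to `V₀ ∩ V₁` coincide (injectivity of `𝓘 ↪ 𝒪`)
  have h₀ : (idealModule ι).presheaf.map (homOfLE (inf_le_right : V₀ ⊓ V₁ ≤ V₁)).op (s₁ j) =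
      (idealModule ι).presheaf.map (homOfLE (inf_le_left : V₀ ⊓ V₁ ≤ V₀)).op (s₀ j) := by
    refine idealModule_section_eq_map_of_toRing_eq ι inf_le_left (s₀ j) _ (hs₀ j) ?_
    rw [← map_toRing, hs₁, ← hagree]
  -- `η` commutes with restriction (the opens `ι⁻¹(V₀ ∩ V₁)` and `ι⁻¹V₀ ∩ ι⁻¹V₁` agree definitionally)
  rw [he₀, he₁]
  have H₀ := unitSectionLE_refl_map ι (inf_le_left : V₀ ⊓ V₁ ≤ V₀) (s₀ j)
  have H₁ := unitSectionLE_refl_map ι (inf_le_right : V₀ ⊓ V₁ ≤ V₁) (s₁ j)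
  rw [h₀] at H₁
  exact H₀.symm.trans H₁

end Agree

/-! ### The two-chart criterion for `Ȟ¹(𝒩) = 0` -/

section Core

variable {X Z : Scheme.{0}} (ι : Z ⟶ X) [IsClosedImmersion ι] [IsLocallyNoetherian X]

/-- A two-member family with prescribed members (dependent `Fin.cons`). [folklore] -/
theorem fin_two_cons_apply_zero {α : Fin 2 → Type} (a : α 0) (b : α 1) :
    (Fin.cons a (Fin.cons b finZeroElim : ∀ i : Fin 1, α i.succ) : ∀ i, α i) 0 = a := rfl

/-- A two-member family with prescribed members, second member. [folklore] -/
theorem fin_two_cons_apply_one {α : Fin 2 → Type} (a : α 0) (b : α 1) :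
    (Fin.cons a (Fin.cons b finZeroElim : ∀ i : Fin 1, α i.succ) : ∀ i, α i) 1 = b := rfl

/-- **`Ȟ¹(𝒩) = 0` from a two-chart certificate with agreeing generators.** Let `ι : Z ⟶ X` be a closed immersion into a
locally Noetherian scheme, `V₀, V₁ ⊆ X` affine opens, `x^a : Fin n → Γ(X, V_a)` quasi-regular sequences generating the ideal
of `ι` on `V_a` which agree on `V₀ ∩ V₁`, and suppose every function on `ι⁻¹V₀ ∩ ι⁻¹V₁` is a difference `w| − v|` of functions
on `ι⁻¹V₁`, `ι⁻¹V₀` (the cochain form of `Ȟ¹((ι⁻¹V₀, ι⁻¹V₁); 𝒪_Z) = 0`). Then the first Čech cohomology of the normal sheaf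
`𝒩_{Z/X} = (ι^*𝓘)^∨` on the two-member family `(ι⁻¹V₀, ι⁻¹V₁)` vanishes.
[cite: Hartshorne1977, III.4 and II.8 Thm. 8.17] (OURS assembly; the mathematics is folklore: `𝒩 ≅ 𝒪ⁿ` on `ι⁻¹V₀ ∪ ι⁻¹V₁`) -/
theorem subsingleton_cechMH1_normalSheaf_of_twoCharts (V : Fin 2 → X.affineOpens) {n : ℕ}
    (x : ∀ a : Fin 2, Fin n → Γ(X, (V a : X.Opens))) (hqr : ∀ a, IsQuasiRegular (x a))
    (hI : ∀ a, Ideal.span (Set.range (x a)) = ι.ker.ideal (V a))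
    (hagree : ∀ j, X.presheaf.map (homOfLE (inf_le_left : (V 0 : X.Opens) ⊓ V 1 ≤ V 0)).op (x 0 j) =
      X.presheaf.map (homOfLE (inf_le_right : (V 0 : X.Opens) ⊓ V 1 ≤ V 1)).op (x 1 j))
    (hsplit : ∀ u : Γ(Z, ι ⁻¹ᵁ (V 0 : X.Opens) ⊓ ι ⁻¹ᵁ (V 1 : X.Opens)),
      ∃ (v : Γ(Z, ι ⁻¹ᵁ (V 0 : X.Opens))) (w : Γ(Z, ι ⁻¹ᵁ (V 1 : X.Opens))),
        u = Z.presheaf.map (homOfLE inf_le_right).op w - Z.presheaf.map (homOfLE inf_le_left).op v) :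
    Subsingleton (CechMH1 Z.toSpecΓ (normalSheaf ι) (fun a => ι ⁻¹ᵁ (V a : X.Opens))) := by
  classical
  obtain ⟨s₀, e₀, hs₀, he₀⟩ := exists_conormalFrame_of_generators_of_isQuasiRegular ι (V 0) (x 0) (hqr 0) (hI 0)
  obtain ⟨s₁, e₁, hs₁, he₁⟩ := exists_conormalFrame_of_generators_of_isQuasiRegular ι (V 1) (x 1) (hqr 1) (hI 1)
  rw [subsingleton_cechMH1_iff]
  intro y
  -- the overlap and the two restricted frames (transition matrix `1`)
  let W : Z.Opens := ι ⁻¹ᵁ (V 0 : X.Opens) ⊓ ι ⁻¹ᵁ (V 1 : X.Opens)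
  let k₀ : W ⟶ ι ⁻¹ᵁ (V 0 : X.Opens) := homOfLE inf_le_left
  let k₁ : W ⟶ ι ⁻¹ᵁ (V 1 : X.Opens) := homOfLE inf_le_right
  let e₀' := SheafOfModules.restrictTrivialisation (R := Z.ringCatSheaf) k₀ e₀
  let e₁' := SheafOfModules.restrictTrivialisation (R := Z.ringCatSheaf) k₁ e₁
  have hb : ∀ j, basisSection e₁' j = basisSection e₀' j := fun j => by
    rw [basisSection_restrictTrivialisation, basisSection_restrictTrivialisation]
    exact (conormal_basisSection_map_eq_of_agree ι (V 0) (V 1) (x 0) (x 1) s₀ s₁ hs₀ hs₁ hagree e₀ e₁ he₀ he₁ j).symm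
  -- the section over the overlap IS a morphism `𝒞|_W ⟶ 𝒪|_W`; split its coordinates
  let μ : (conormalSheaf ι).over W ⟶ (unitModule Z).over W := y
  choose v w hvw using fun j => hsplit (dualCoord e₀' μ j)
  -- the lifts on the two charts
  let b₀ : (conormalSheaf ι).over (ι ⁻¹ᵁ (V 0 : X.Opens)) ⟶ (unitModule Z).over (ι ⁻¹ᵁ (V 0 : X.Opens)) :=
    homOfBasisValues e₀ (M := unitModule Z) v
  let b₁ : (conormalSheaf ι).over (ι ⁻¹ᵁ (V 1 : X.Opens)) ⟶ (unitModule Z).over (ι ⁻¹ᵁ (V 1 : X.Opens)) :=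
    homOfBasisValues e₁ (M := unitModule Z) w
  refine ⟨Fin.cons (b₀ : MSections Z.toSpecΓ (normalSheaf ι) (ι ⁻¹ᵁ (V 0 : X.Opens)))
    (Fin.cons (b₁ : MSections Z.toSpecΓ (normalSheaf ι) (ι ⁻¹ᵁ (V 1 : X.Opens))) finZeroElim), ?_⟩
  rw [cechDelta_apply, fin_two_cons_apply_zero, fin_two_cons_apply_one, MSections.res_apply, MSections.res_apply,
    normalSheaf_presheaf_map, normalSheaf_presheaf_map]
  -- compare coordinates in the frame `e₀'`
  change (restrictHom k₁ b₁ - restrictHom k₀ b₀ : (conormalSheaf ι).over W ⟶ (unitModule Z).over W) = μ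
  refine dualCoord_injective e₀' (funext fun j => ?_)
  change dualCoord e₀' (restrictHom k₁ b₁ - restrictHom k₀ b₀) j = dualCoord e₀' μ j
  rw [dualCoord_sub, dualCoord_restrictTrivialisation e₀ k₀ b₀ j, dualCoord_homOfBasisValues,
    dualCoord_def e₀', ← hb j, ← dualCoord_def e₁', dualCoord_restrictTrivialisation e₁ k₁ b₁ j,
    dualCoord_homOfBasisValues]
  exact (hvw j).symm

end Core

/-! ### The socket form -/

section Socket

/-- **(P4-ν) — `DirStepUnobs` from a two-chart certificate.** For the inclusion `i₀ : Γ̃ ⟶ Ẽ` of the reduced structures on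
closed subsets `Γ ⊆ E` of `G` (`Ẽ` locally Noetherian): two affine opens `V₀, V₁ ⊆ Ẽ` with affine intersection whose
preimages cover `Γ̃`, agreeing quasi-regular generators of the ideal of `i₀` on them, and the cochain form of
`Ȟ¹((i₀⁻¹V₀, i₀⁻¹V₁); 𝒪_{Γ̃}) = 0` give `DirStepUnobs G E hE Γ hΓ` (`Ȟ¹(Γ̃, 𝒩_{Γ̃/Ẽ}) = 0` on that cover, for EVERY
inclusion `i` over `G` — they all equal `i₀`). [OURS · L1 W4.5b · EL♮(3) · nose residue (P4-ν); NOT a statement of the manuscript] -/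
theorem dirStepUnobs_of_twoCharts (G : Scheme.{0}) (E : Set G) (hE : IsClosed E) (Γ : Set G) (hΓ : IsClosed Γ)
    [IsLocallyNoetherian (redSub G E hE)]
    (i₀ : redSub G Γ hΓ ⟶ redSub G E hE) [IsClosedImmersion i₀] (hi₀ : i₀ ≫ redSubι G E hE = redSubι G Γ hΓ)
    (V : Fin 2 → (redSub G E hE).affineOpens) (hV01 : IsAffineOpen ((V 0 : (redSub G E hE).Opens) ⊓ V 1))
    (hcov : (⨆ a, i₀ ⁻¹ᵁ (V a : (redSub G E hE).Opens)) = ⊤)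
    {n : ℕ} (x : ∀ a : Fin 2, Fin n → Γ(redSub G E hE, (V a : (redSub G E hE).Opens)))
    (hqr : ∀ a, IsQuasiRegular (x a)) (hI : ∀ a, Ideal.span (Set.range (x a)) = i₀.ker.ideal (V a))
    (hagree : ∀ j, (redSub G E hE).presheaf.map (homOfLE (inf_le_left : (V 0 : (redSub G E hE).Opens) ⊓ V 1 ≤ V 0)).op (x 0 j) =
      (redSub G E hE).presheaf.map (homOfLE (inf_le_right : (V 0 : (redSub G E hE).Opens) ⊓ V 1 ≤ V 1)).op (x 1 j))
    (hsplit : ∀ u : Γ(redSub G Γ hΓ, i₀ ⁻¹ᵁ (V 0 : (redSub G E hE).Opens) ⊓ i₀ ⁻¹ᵁ (V 1 : (redSub G E hE).Opens)),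
      ∃ (v : Γ(redSub G Γ hΓ, i₀ ⁻¹ᵁ (V 0 : (redSub G E hE).Opens)))
        (w : Γ(redSub G Γ hΓ, i₀ ⁻¹ᵁ (V 1 : (redSub G E hE).Opens))),
        u = (redSub G Γ hΓ).presheaf.map (homOfLE inf_le_right).op w -
          (redSub G Γ hΓ).presheaf.map (homOfLE inf_le_left).op v) :
    DirStepUnobs G E hE Γ hΓ := by
  intro i hi
  -- every inclusion over `G` is `i₀`
  obtain rfl : i = i₀ := by
    rw [← cancel_mono (redSubι G E hE), hi, hi₀]
  refine ⟨fun a => i ⁻¹ᵁ (V a : (redSub G E hE).Opens), fun a => (V a).2.preimage i, hV01.preimage i, hcov, ?_⟩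
  exact subsingleton_cechMH1_normalSheaf_of_twoCharts i V x hqr hI hagree hsplit

end Socket

end Summit.ResolutionOfSingularities.ResolutionOfSingularities.Cruxes.EquisingularLiftNat.Sections

end
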